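import Literature.MathematicalPhysics.QuantumFieldTheory.Balaban1983to89.Beta.CompositionSingular
import Literature.Analysis.Calculus.JacobiFormula

/-!
# `Balaban1983to89.Beta.BorderedJets` — BETA sub-cell, row an1 (b2b-balaban-beta-an1): the GENERIC HALF of brick (V-H)
— exact resolvent identities and the first- and second-order JETS of the fluctuation covariance `𝒢`, the minimiser `ℋ`,
its left companion `ℋᴸ` and the effective form `𝒮` of a constrained datum `(H, Q)` under a perturbation
`(H, Q) ↦ (H + δH, Q + δQ)`, plus the one-loop tadpole `d/dt log det kkt` over `ℝ`; kernel-checked finite-dimensional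
algebra, `[folklore]` throughout

HONEST FRAMING (cell file `HOME/BETA-SPEC.md`, verbatim): discharging `BetaPertH` makes Bałaban's UV stability
UNCONDITIONAL — a real constructive-QFT result; it is NOT the continuum limit and NOT the Clay problem.  THIS MODULE
DISCHARGES NOTHING of `FlowStep.BetaPertH` / (M2⁺): it asserts nothing about Bałaban's β-functions (1.22), proves NO
bound, NO exponential decay and NO `k`-uniformity, and never touches his concrete lattice operators `Δ(U)`, `Q(U)`,
`R(U)D*_U`, `G`, `H`, `G₁`, `H₁`.  Value = kernel identities (the perturbation calculus of a bordered inverse), NOT summit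
progress.  ABSOLUTE RULE (cell rule, verbatim): "No internally-minted statement may enter as a cited fact. Every
hypothesis is either kernel-proved in this package or a verbatim quotation of a PUBLISHED theorem with page reference.
The manuscript(s) under audit are NOT citable for their own disputed steps — they are the thing under adjudication;
programme-internal (2001/route/tribunal) claims are never citable."  Every declaration below is `[folklore]` linear
algebra proved here; the papers are cited for ORIENTATION of the dictionary only.

CITATION HEADER (lean-in-tree rule 2026-08-18).  The background dependence whose jets this file organises is the one
printed in T. Bałaban, "Propagators for lattice gauge theories in a background field", *Comm. Math. Phys.* **99**,
389–434 (1985) [Balaban1985BackgroundPropagators] (cell paper B9), Sect. D — quoted here exactly as transcribed from the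
cell's page renders `HOME/b2b-balaban-ref1/pages/1985-cmp99-background-propagators-…` in `HOME/BETA/OBJECTS.md` §2, §10
and in the header of the tree module `Beta.CompositionSingular` (an2):  p. 417, (3.109)–(3.112): «we define H(U)B, or
simply HB, as a minimal configuration of the functional A → ½⟨A, Δ(U)A⟩ (3.109) on a set of configurations A …
satisfying L^jηQ_j(U)A = B on Λ_j, j = 0,1,…,k, R(U)D*_U A = 0 (3.110) …»;  p. 420, (3.122)–(3.126): «G⁻¹ defined as
G⁻¹ = Δ_π + DRD* + Q*aQ … A = GQ*(QGQ*)⁻¹B … HB = GQ*(QGQ*)⁻¹B (3.126)»;  p. 421 (3.129) «H₁B = G₁Q*(QG₁Q*)⁻¹B».  So the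
form `H = Δ(U)`, the constraint map `Q = Q(U)` AND the slice `R(U)D*_U` all depend on the background `U`; in the bordered
language of `Beta.CompositionSingular` a slice enters either as extra constraint rows (stacked into `Q`, cf.
`Beta.GaugeFixingPropagators`' `[Q; τ]`) or as a weight added to `H` (`H + τᵀAτ`, [B9] (3.121)/(3.122)), so its
`U`-variation is a `(δH, δQ)` of this file in either reading.  T. Bałaban, "Renormalization group approach to lattice
gauge field theories. I", *Comm. Math. Phys.* **109**, 249–301 (1987) [Balaban1987RG1] (cell paper B12), p. 267 [PDF 19]
(render `…-p019-x2.png`, the sentence on the linear term just above (2.11); locator corrected in v1.0.1 after XREAD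
C-pv09g8-4 D1 — v1 had «p. 268 L1–12», inherited): «⟨δA′,J⟩ = 0 for all δA′ satisfying the condition Q̃Q_kδA′ = 0, and
H₁B′ satisfies it» — the first-order condition of the constrained minimiser; the present file is the calculus of how that minimiser, the
fluctuation covariance and the effective action MOVE when the datum moves.

WHAT IS PROVED (over an arbitrary `Field 𝕜` in §1–§7, over `ℝ` in §8; `kkt H Q = [[H, Qᵀ],[Q, 0]]` is
`Beta.Composition.kkt`; `flucCov` 𝒢, `minOp` ℋ, `minOpL` ℋᴸ, `effForm` 𝒮, `kktInv_eq_fromBlocks`, `minOpL_eq_transpose`,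
`transpose_minOp_mul_mul_minOp` are an2's `Beta.CompositionSingular` (p185365), consumed BY NAME — nothing restated; the
standing hypotheses are the same single ones as there: `IsUnit (kkt H Q).det` and, for exact identities, also
`IsUnit (kkt (H+δH) (Q+δQ)).det`).
* §1 EXACT RESOLVENT IDENTITIES for square matrices `M`, `M + D` both invertible: (J1) `(M+D)⁻¹ = M⁻¹ − M⁻¹D(M+D)⁻¹ =
  M⁻¹ − (M+D)⁻¹DM⁻¹` (`inv_add_eq_sub_right/left`); (J2) `… = M⁻¹ − M⁻¹DM⁻¹ + M⁻¹DM⁻¹D(M+D)⁻¹` (`inv_add_eq_second`); (J3)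
  `… = M⁻¹ − XM⁻¹ + X²M⁻¹ − X³(M+D)⁻¹`, `X := M⁻¹D` (`inv_add_eq_third`); `det (M+D) = det M · det (1 + M⁻¹D)`
  (`det_add_eq_det_mul`); and the SECOND-ORDER TAYLOR IDENTITY WITH EXACT REMAINDER along a polynomial line
  `M(t) = M + tD₁ + t²D₂`: `M(t)⁻¹ = M⁻¹ + t·(−X₁M⁻¹) + t²·(X₁X₁M⁻¹ − X₂M⁻¹) + t³·R(t)`, `R(t) = (X₁X₂ + X₂X₁ + tX₂X₂)M⁻¹ −
  (X₁ + tX₂)³M(t)⁻¹` (`inv_line_taylor₂`) — so the Taylor COEFFICIENTS are identified purely algebraically, with no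
  topology on `𝕜`.
* §2 THE PERTURBATION IS BORDERED: `kkt (H+δH) (Q+δQ) = kkt H Q + kkt δH δQ` (`kkt_add`; `kkt_smul`, `kkt_zero`,
  `kkt_line`); the DRESSED PERTURBATION `dressed H Q δH δQ := (kkt H Q)⁻¹ · kkt δH δQ` and its blocks
  `X = [[𝒢δH + ℋδQ, 𝒢δQᵀ],[ℋᴸδH − 𝒮δQ, ℋᴸδQᵀ]]` (`dressed_eq_fromBlocks`); the jets `jet₁ := −X·(kkt H Q)⁻¹`,
  `jet₂ δ δ' := X(δ)X(δ')(kkt H Q)⁻¹ = −X(δ)·jet₁(δ')`; additivity/homogeneity in the perturbation.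
* §3 THE FIRST-ORDER JETS OF THE FOUR BLOCKS as named operators (`dFlucCov`, `dMinOp`, `dMinOpL`, `dEffForm` = the blocks
  of `jet₁`, the `₂₂` one sign-adjusted to `𝒮 = −(kkt⁻¹)₂₂`) WITH THEIR EXPLICIT VERTEX FORM:
  `dℋ = −𝒢·δH·ℋ − ℋ·δQ·ℋ + 𝒢·δQᵀ·𝒮` (`dMinOp_eq`), `d𝒮 = ℋᴸ·δH·ℋ − 𝒮·δQ·ℋ − ℋᴸ·δQᵀ·𝒮` (`dEffForm_eq`),
  `d𝒢 = −𝒢·δH·𝒢 − ℋ·δQ·𝒢 − 𝒢·δQᵀ·ℋᴸ` (`dFlucCov_eq`), `dℋᴸ = −ℋᴸ·δH·𝒢 + 𝒮·δQ·𝒢 − ℋᴸ·δQᵀ·ℋᴸ` (`dMinOpL_eq`); linearity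
  (`dBlocks_add`, `dBlocks_smul`).
* §4 EXACT PERTURBATION IDENTITIES: Dyson form `(kkt')⁻¹ = kkt⁻¹ − X·(kkt')⁻¹` (`kktInv_pert`), first- and second-order
  Taylor forms with exact remainders `X²(kkt')⁻¹`, `X³(kkt')⁻¹` (`kktInv_pert₂`, `kktInv_pert₃`); the FOUR DYSON
  IDENTITIES block by block, e.g. `ℋ' = ℋ − ((𝒢δH + ℋδQ)ℋ' − 𝒢δQᵀ𝒮')`, `𝒮' = 𝒮 + ((ℋᴸδH − 𝒮δQ)ℋ' − ℋᴸδQᵀ𝒮')`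
  (`blocks_pert`), and the first-order block expansions with exact second-order remainder `R = X²(kkt')⁻¹`:
  `ℋ' = ℋ + dℋ + R₁₂`, `𝒮' = 𝒮 + d𝒮 − R₂₂`, … (`blocks_pert₂`).
* §5 SECOND ORDER: the blocks of `jet₂` through the first-order jets — `(jet₂ δ δ')₁₂ = −(𝒢δH + ℋδQ)·dℋ(δ') + 𝒢δQᵀ·d𝒮(δ')`,
  `−(jet₂ δ δ')₂₂ = (ℋᴸδH − 𝒮δQ)·dℋ(δ') − ℋᴸδQᵀ·d𝒮(δ')`, `(jet₂ δ δ')₁₁ = …` (`jet₂_toBlocks₁₂`, `neg_jet₂_toBlocks₂₂`,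
  `jet₂_toBlocks₁₁`); the bordered Taylor identity along a polynomial line of data `t ↦ (H + tH₁ + t²H₂, Q + tQ₁ + t²Q₂)`
  (`kktInv_line_taylor₂`, remainder `lineRem`) and its read-out «THE B-JETS OF THE MINIMISER AND OF THE EFFECTIVE ACTION
  TO SECOND ORDER»: `ℋ(t) = ℋ + t·dℋ(1) + t²·(−(𝒢H₁ + ℋQ₁)·dℋ(1) + 𝒢Q₁ᵀ·d𝒮(1) + dℋ(2)) + t³·(lineRem t)₁₂`,
  `𝒮(t) = 𝒮 + t·d𝒮(1) + t²·(d𝒮(2) + (ℋᴸH₁ − 𝒮Q₁)·dℋ(1) − ℋᴸQ₁ᵀ·d𝒮(1)) − t³·(lineRem t)₂₂` (`minOp_effForm_line_taylor₂`) —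
  one second-order vertex PLUS two first-order vertices joined by one fluctuation propagator.
* §6 SPECIALISATIONS: pure Hessian perturbation `δQ = 0` — `dℋ = −𝒢δHℋ`, HELLMANN–FEYNMAN `d𝒮 = ℋᴸδHℋ` (the first variation
  of the constrained minimum is the Hessian variation evaluated on the unperturbed minimiser), `d𝒢 = −𝒢δH𝒢`, and the
  two-vertex second-order term `−ℋᴸ·δH·𝒢·δH'·ℋ` (`dBlocks_hessian`, `neg_jet₂_toBlocks₂₂_hessian`); symmetric data `Hᵀ = H`
  — `d𝒮 = ℋᵀδHℋ − (𝒮δQℋ + (𝒮δQℋ)ᵀ)` (`dEffForm_eq_of_symm'`, `effForm_jets_hessian_of_symm`).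
* §7 TRACES: `tr X = tr (𝒢δH + ℋδQ) + tr (ℋᴸδQᵀ)`, `= tr (𝒢δH) + 2·tr (ℋδQ)` for symmetric data (`trace_dressed`,
  `trace_dressed_of_symm`).
* §8 OVER `ℝ` (from the tree's `Literature.Analysis.Calculus.JacobiFormula.hasDerivAt_det_eq_det_mul_trace` BY NAME): Jacobi
  along an affine line `d/dt|₀ log det (M + tD) = tr (M⁻¹D)` for `det M ≠ 0` (`hasDerivAt_log_det_line`; Mathlib's
  `Real.log = log |·|`), hence THE ONE-LOOP TADPOLE of a constrained Gaussian
  `d/dt|₀ log det kkt (H + tH₁) (Q + tQ₁) = tr (𝒢H₁ + ℋQ₁) + tr (ℋᴸQ₁ᵀ)` (`hasDerivAt_log_det_kkt_line`), `= tr (𝒢H₁) +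
  2·tr (ℋQ₁)` for symmetric data (`…_of_symm`).
* §9 non-vacuity of the standing hypotheses on the one-dimensional datum.

NOT PROVED / NOT TYPED HERE (located, for the consumers): (a) any SIZE statement (operator norms of the jets, exponential
decay, `k`-uniformity) — the jets are exact algebraic expressions in `𝒢, ℋ, ℋᴸ, 𝒮` and the vertices, so every decay
bound is inherited from bounds on those, which are the open analytic items (M2⁺) of the cell; (b) the SECOND derivative
of `log det` along a polynomial line (`tr X₂ − ½ tr X₁²`), i.e. the full one-loop part of `∂²_B log Z` — not RESTATED
here because the tree HAS it: `Beta.LogDetHessian.fderiv_fderiv_log_det` (+ `fderiv_fderiv_log_det_entrywise`,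
`polarization_eq_trace`, `polarization_eq_trace_of_regular`; pv09-g3 p178018), consumed BY NAME by the owner of (T-def)
(XREAD C-pv09g8-4 D2); (c) the CONCRETE
jets `δH` (the Wilson-Hessian jets, an3's brick (V-Δ): `Beta.PlaquetteVertex`, WEITZENBOCK-GERM) and `δQ` (the averaging
jets: an2's `Beta.AffineAveraging` exact affine form, an1's `Beta.GaugeTermBackground` first order) — they are plugged
into `dMinOp_eq` / `dEffForm_eq` / `minOp_effForm_line_taylor₂` BY NAME by the owner of brick (T-def) (an2, GAPS C-an2-47;
cell RULING (R18-3) names an1 for «(V-H)/(V-J)»: (V-J) = `Beta.MultiplierSector`, this file = the generic half of (V-H)).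
Record: `HOME/BETA/AN1.md` §25; GAPS C-an1-44.  v1 p185768 (2026-08-19); v1.0.1 = DOCFIX (docstring-only, three
locator/pointer hunks after XREAD C-pv09g8-4; every declaration byte-identical to v1).
-/

noncomputable section

namespace Literature.MathematicalPhysics.QuantumFieldTheory.Balaban1983to89.Beta.BorderedJets

open Literature.MathematicalPhysics.QuantumFieldTheory.Balaban1983to89.Beta.Composition (kkt)
open Literature.MathematicalPhysics.QuantumFieldTheory.Balaban1983to89.Beta.CompositionSingular
open scoped Matrix
open Matrix

/-! ## §1. Exact resolvent identities (any square matrices over a field) -/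

section Resolvent

variable {𝕜 : Type*} [Field 𝕜] {ι : Type*} [Fintype ι] [DecidableEq ι]

/-- (J1, right form) The EXACT first-order resolvent identity: if `M` and `M + D` are invertible then
`(M + D)⁻¹ = M⁻¹ − M⁻¹ · D · (M + D)⁻¹`. [folklore] -/
theorem inv_add_eq_sub_right (M D : Matrix ι ι 𝕜) (hM : IsUnit M.det) (hM' : IsUnit (M + D).det) :
    (M + D)⁻¹ = M⁻¹ - M⁻¹ * D * (M + D)⁻¹ := by
  have h1 : M⁻¹ * (M + D) * (M + D)⁻¹ = M⁻¹ := by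
    rw [Matrix.mul_assoc, Matrix.mul_nonsing_inv _ hM', Matrix.mul_one]
  rw [Matrix.mul_add, Matrix.nonsing_inv_mul _ hM, Matrix.add_mul, Matrix.one_mul] at h1
  rw [eq_sub_iff_add_eq]
  exact h1

/-- (J1, left form) `(M + D)⁻¹ = M⁻¹ − (M + D)⁻¹ · D · M⁻¹`. [folklore] -/
theorem inv_add_eq_sub_left (M D : Matrix ι ι 𝕜) (hM : IsUnit M.det) (hM' : IsUnit (M + D).det) :
    (M + D)⁻¹ = M⁻¹ - (M + D)⁻¹ * D * M⁻¹ := by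
  have h1 : (M + D)⁻¹ * ((M + D) * M⁻¹) = M⁻¹ := by
    rw [← Matrix.mul_assoc, Matrix.nonsing_inv_mul _ hM', Matrix.one_mul]
  rw [Matrix.add_mul, Matrix.mul_nonsing_inv _ hM, Matrix.mul_add, Matrix.mul_one, ← Matrix.mul_assoc] at h1
  rw [eq_sub_iff_add_eq]
  exact h1

/-- (J2) The EXACT second-order resolvent identity:
`(M + D)⁻¹ = M⁻¹ − M⁻¹DM⁻¹ + M⁻¹DM⁻¹D(M + D)⁻¹`. [folklore] -/
theorem inv_add_eq_second (M D : Matrix ι ι 𝕜) (hM : IsUnit M.det) (hM' : IsUnit (M + D).det) :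
    (M + D)⁻¹ = M⁻¹ - M⁻¹ * D * M⁻¹ + M⁻¹ * D * M⁻¹ * D * (M + D)⁻¹ := by
  apply Matrix.inv_eq_left_inv
  have e1 : M⁻¹ * (M + D) = 1 + M⁻¹ * D := by rw [Matrix.mul_add, Matrix.nonsing_inv_mul _ hM]
  have e2 : M⁻¹ * D * M⁻¹ * (M + D) = M⁻¹ * D + M⁻¹ * D * M⁻¹ * D := by
    rw [Matrix.mul_add, Matrix.mul_assoc (M⁻¹ * D), Matrix.nonsing_inv_mul _ hM, Matrix.mul_one]
  have e3 : M⁻¹ * D * M⁻¹ * D * (M + D)⁻¹ * (M + D) = M⁻¹ * D * M⁻¹ * D := by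
    rw [Matrix.mul_assoc (M⁻¹ * D * M⁻¹ * D), Matrix.nonsing_inv_mul _ hM', Matrix.mul_one]
  rw [Matrix.add_mul, Matrix.sub_mul, e1, e2, e3]
  abel

/-- (J3) The EXACT third-order resolvent identity:
`(M + D)⁻¹ = M⁻¹ − XM⁻¹ + X²M⁻¹ − X³(M + D)⁻¹` with the DRESSED PERTURBATION `X := M⁻¹D`. [folklore] -/
theorem inv_add_eq_third (M D : Matrix ι ι 𝕜) (hM : IsUnit M.det) (hM' : IsUnit (M + D).det) :
    (M + D)⁻¹ = M⁻¹ - M⁻¹ * D * M⁻¹ + M⁻¹ * D * (M⁻¹ * D) * M⁻¹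
      - M⁻¹ * D * (M⁻¹ * D) * (M⁻¹ * D) * (M + D)⁻¹ := by
  apply Matrix.inv_eq_left_inv
  have e1 : M⁻¹ * (M + D) = 1 + M⁻¹ * D := by rw [Matrix.mul_add, Matrix.nonsing_inv_mul _ hM]
  have e2 : M⁻¹ * D * M⁻¹ * (M + D) = M⁻¹ * D + M⁻¹ * D * (M⁻¹ * D) := by
    rw [Matrix.mul_add, Matrix.mul_assoc (M⁻¹ * D), Matrix.nonsing_inv_mul _ hM, Matrix.mul_one,
      Matrix.mul_assoc (M⁻¹ * D)]
  have e3 : M⁻¹ * D * (M⁻¹ * D) * M⁻¹ * (M + D) =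
      M⁻¹ * D * (M⁻¹ * D) + M⁻¹ * D * (M⁻¹ * D) * (M⁻¹ * D) := by
    rw [Matrix.mul_add, Matrix.mul_assoc (M⁻¹ * D * (M⁻¹ * D)), Matrix.nonsing_inv_mul _ hM, Matrix.mul_one,
      Matrix.mul_assoc (M⁻¹ * D * (M⁻¹ * D)) M⁻¹ D]
  have e4 : M⁻¹ * D * (M⁻¹ * D) * (M⁻¹ * D) * (M + D)⁻¹ * (M + D) = M⁻¹ * D * (M⁻¹ * D) * (M⁻¹ * D) := by
    rw [Matrix.mul_assoc (M⁻¹ * D * (M⁻¹ * D) * (M⁻¹ * D)), Matrix.nonsing_inv_mul _ hM', Matrix.mul_one]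
  rw [Matrix.sub_mul, Matrix.add_mul, Matrix.sub_mul, e1, e2, e3, e4]
  abel

/-- The determinant side of the same bookkeeping: `det (M + D) = det M · det (1 + M⁻¹D)`. [folklore] -/
theorem det_add_eq_det_mul (M D : Matrix ι ι 𝕜) (hM : IsUnit M.det) :
    (M + D).det = M.det * (1 + M⁻¹ * D).det := by
  rw [← Matrix.det_mul, Matrix.mul_add, Matrix.mul_one, ← Matrix.mul_assoc, Matrix.mul_nonsing_inv _ hM,
    Matrix.one_mul]

/-- SECOND-ORDER TAYLOR IDENTITY WITH EXACT REMAINDER along a polynomial line `M(t) = M + t·D₁ + t²·D₂`: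
with the dressed vertices `X₁ := M⁻¹D₁`, `X₂ := M⁻¹D₂` and `Y(t) := X₁ + t·X₂`,
`M(t)⁻¹ = M⁻¹ + t·(−X₁M⁻¹) + t²·(X₁X₁M⁻¹ − X₂M⁻¹) + t³·R(t)`,
`R(t) = (X₁X₂ + X₂X₁ + t·X₂X₂)M⁻¹ − Y(t)³·M(t)⁻¹` — so `−X₁M⁻¹` and `X₁X₁M⁻¹ − X₂M⁻¹` ARE the first two Taylor
coefficients of `t ↦ M(t)⁻¹` at `t = 0` (the remainder is `t³` times a matrix polynomial in `t` and `M(t)⁻¹`).  Purely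
algebraic: no topology on `𝕜` is used. [folklore] -/
theorem inv_line_taylor₂ (M D₁ D₂ : Matrix ι ι 𝕜) (t : 𝕜) (hM : IsUnit M.det)
    (hMt : IsUnit (M + (t • D₁ + t ^ 2 • D₂)).det) :
    (M + (t • D₁ + t ^ 2 • D₂))⁻¹ = M⁻¹ + t • (-(M⁻¹ * D₁ * M⁻¹))
      + t ^ 2 • (M⁻¹ * D₁ * (M⁻¹ * D₁) * M⁻¹ - M⁻¹ * D₂ * M⁻¹)
      + t ^ 3 • ((M⁻¹ * D₁ * (M⁻¹ * D₂) + M⁻¹ * D₂ * (M⁻¹ * D₁) + t • (M⁻¹ * D₂ * (M⁻¹ * D₂))) * M⁻¹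
          - (M⁻¹ * D₁ + t • (M⁻¹ * D₂)) * (M⁻¹ * D₁ + t • (M⁻¹ * D₂)) * (M⁻¹ * D₁ + t • (M⁻¹ * D₂))
              * (M + (t • D₁ + t ^ 2 • D₂))⁻¹) := by
  have h := inv_add_eq_third M (t • D₁ + t ^ 2 • D₂) hM hMt
  -- the dressed perturbation is `t · Y(t)`
  have hX : M⁻¹ * (t • D₁ + t ^ 2 • D₂) = t • (M⁻¹ * D₁ + t • (M⁻¹ * D₂)) := by
    rw [Matrix.mul_add, Matrix.mul_smul, Matrix.mul_smul, smul_add, smul_smul, pow_two]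
  refine h.trans ?_
  rw [hX]
  have hY1 : (M⁻¹ * D₁ + t • (M⁻¹ * D₂)) * M⁻¹ = M⁻¹ * D₁ * M⁻¹ + t • (M⁻¹ * D₂ * M⁻¹) := by
    rw [Matrix.add_mul, Matrix.smul_mul]
  have hY2 : (M⁻¹ * D₁ + t • (M⁻¹ * D₂)) * (M⁻¹ * D₁ + t • (M⁻¹ * D₂)) = M⁻¹ * D₁ * (M⁻¹ * D₁) + t • (M⁻¹ * D₁ * (M⁻¹ * D₂) + M⁻¹ * D₂ * (M⁻¹ * D₁) + t • (M⁻¹ * D₂ * (M⁻¹ * D₂))) := by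
    rw [Matrix.add_mul, Matrix.mul_add, Matrix.mul_add, Matrix.smul_mul, Matrix.smul_mul, Matrix.mul_smul,
      Matrix.mul_smul, smul_smul, smul_add, smul_add, smul_smul]
    abel
  have e1 : t • (M⁻¹ * D₁ + t • (M⁻¹ * D₂)) * M⁻¹ = t • (M⁻¹ * D₁ * M⁻¹) + t ^ 2 • (M⁻¹ * D₂ * M⁻¹) := by
    rw [Matrix.smul_mul, hY1]
    module
  have e2 : t • (M⁻¹ * D₁ + t • (M⁻¹ * D₂)) * (t • (M⁻¹ * D₁ + t • (M⁻¹ * D₂))) * M⁻¹ =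
      t ^ 2 • (M⁻¹ * D₁ * (M⁻¹ * D₁) * M⁻¹) + t ^ 3 • ((M⁻¹ * D₁ * (M⁻¹ * D₂) + M⁻¹ * D₂ * (M⁻¹ * D₁) + t • (M⁻¹ * D₂ * (M⁻¹ * D₂))) * M⁻¹) := by
    have : t • (M⁻¹ * D₁ + t • (M⁻¹ * D₂)) * (t • (M⁻¹ * D₁ + t • (M⁻¹ * D₂))) * M⁻¹ = (t * t) • ((M⁻¹ * D₁ + t • (M⁻¹ * D₂)) * (M⁻¹ * D₁ + t • (M⁻¹ * D₂)) * M⁻¹) := by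
      rw [Matrix.smul_mul, Matrix.mul_smul, smul_smul, Matrix.smul_mul]
    rw [this, hY2, Matrix.add_mul, Matrix.smul_mul]
    module
  have e3 : t • (M⁻¹ * D₁ + t • (M⁻¹ * D₂)) * (t • (M⁻¹ * D₁ + t • (M⁻¹ * D₂))) * (t • (M⁻¹ * D₁ + t • (M⁻¹ * D₂))) * (M + (t • D₁ + t ^ 2 • D₂))⁻¹ =
      t ^ 3 • ((M⁻¹ * D₁ + t • (M⁻¹ * D₂)) * (M⁻¹ * D₁ + t • (M⁻¹ * D₂)) * (M⁻¹ * D₁ + t • (M⁻¹ * D₂)) * (M + (t • D₁ + t ^ 2 • D₂))⁻¹) := by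
    simp only [Matrix.smul_mul, Matrix.mul_smul, smul_smul]
    module
  rw [e1, e2, e3, smul_neg, smul_sub, smul_sub]
  module

end Resolvent

/-! ## §2. The bordered perturbation and the dressed vertices -/

section Bordered

variable {𝕜 : Type*} [Field 𝕜]
variable {ν μ : Type*} [Fintype ν] [Fintype μ] [DecidableEq ν] [DecidableEq μ]

omit [Fintype ν] [Fintype μ] [DecidableEq ν] [DecidableEq μ] in
/-- (J0) A perturbation of a constrained datum IS bordered: `kkt (H + δH) (Q + δQ) = kkt H Q + kkt δH δQ`
(the perturbation matrix `kkt δH δQ = [[δH, δQᵀ],[δQ, 0]]` has a zero corner). [folklore] -/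
theorem kkt_add (H δH : Matrix ν ν 𝕜) (Q δQ : Matrix μ ν 𝕜) :
    kkt (H + δH) (Q + δQ) = kkt H Q + kkt δH δQ := by
  unfold kkt
  rw [Matrix.fromBlocks_add, Matrix.transpose_add, add_zero]

omit [Fintype ν] [Fintype μ] [DecidableEq ν] [DecidableEq μ] in
/-- Homogeneity: `kkt (c • H) (c • Q) = c • kkt H Q`. [folklore] -/
theorem kkt_smul (c : 𝕜) (H : Matrix ν ν 𝕜) (Q : Matrix μ ν 𝕜) : kkt (c • H) (c • Q) = c • kkt H Q := by
  unfold kkt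
  rw [Matrix.fromBlocks_smul, Matrix.transpose_smul, smul_zero]

omit [Fintype ν] [Fintype μ] [DecidableEq ν] [DecidableEq μ] in
/-- `kkt 0 0 = 0`. [folklore] -/
theorem kkt_zero : kkt (0 : Matrix ν ν 𝕜) (0 : Matrix μ ν 𝕜) = 0 := by
  unfold kkt
  rw [Matrix.transpose_zero, Matrix.fromBlocks_zero]

omit [Fintype ν] [Fintype μ] [DecidableEq ν] [DecidableEq μ] in
/-- A polynomial line of data is a polynomial line of bordered matrices:
`kkt (H + (tH₁ + t²H₂)) (Q + (tQ₁ + t²Q₂)) = kkt H Q + (t · kkt H₁ Q₁ + t² · kkt H₂ Q₂)`. [folklore] -/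
theorem kkt_line (H H₁ H₂ : Matrix ν ν 𝕜) (Q Q₁ Q₂ : Matrix μ ν 𝕜) (t : 𝕜) :
    kkt (H + (t • H₁ + t ^ 2 • H₂)) (Q + (t • Q₁ + t ^ 2 • Q₂)) =
      kkt H Q + (t • kkt H₁ Q₁ + t ^ 2 • kkt H₂ Q₂) := by
  rw [kkt_add, kkt_add, kkt_smul, kkt_smul]

/-- The DRESSED PERTURBATION `X := (kkt H Q)⁻¹ · kkt δH δQ` ("propagator × vertex"). [folklore] -/
def dressed (H : Matrix ν ν 𝕜) (Q : Matrix μ ν 𝕜) (δH : Matrix ν ν 𝕜) (δQ : Matrix μ ν 𝕜) :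
    Matrix (ν ⊕ μ) (ν ⊕ μ) 𝕜 :=
  (kkt H Q)⁻¹ * kkt δH δQ

/-- The FIRST-ORDER JET of the bordered inverse: `jet₁ := −(kkt H Q)⁻¹ · kkt δH δQ · (kkt H Q)⁻¹ = −X · (kkt H Q)⁻¹`.
[folklore] -/
def jet₁ (H : Matrix ν ν 𝕜) (Q : Matrix μ ν 𝕜) (δH : Matrix ν ν 𝕜) (δQ : Matrix μ ν 𝕜) :
    Matrix (ν ⊕ μ) (ν ⊕ μ) 𝕜 :=
  -(dressed H Q δH δQ * (kkt H Q)⁻¹)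

/-- The (polarised) SECOND-ORDER JET of the bordered inverse: `jet₂ δ δ' := X(δ) · X(δ') · (kkt H Q)⁻¹`; the
diagonal `jet₂ δ δ` is the `t²`-coefficient for the line `t ↦ (H + tδH, Q + tδQ)`. [folklore] -/
def jet₂ (H : Matrix ν ν 𝕜) (Q : Matrix μ ν 𝕜) (δH : Matrix ν ν 𝕜) (δQ : Matrix μ ν 𝕜)
    (δH' : Matrix ν ν 𝕜) (δQ' : Matrix μ ν 𝕜) : Matrix (ν ⊕ μ) (ν ⊕ μ) 𝕜 :=
  dressed H Q δH δQ * dressed H Q δH' δQ' * (kkt H Q)⁻¹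

/-- `jet₂ δ δ' = −X(δ) · jet₁ δ'`. [folklore] -/
theorem jet₂_eq_neg_dressed_mul_jet₁ (H δH δH' : Matrix ν ν 𝕜) (Q δQ δQ' : Matrix μ ν 𝕜) :
    jet₂ H Q δH δQ δH' δQ' = -(dressed H Q δH δQ * jet₁ H Q δH' δQ') := by
  unfold jet₂ jet₁
  rw [Matrix.mul_neg, neg_neg, Matrix.mul_assoc]

/-- Additivity of the dressed perturbation in the perturbation. [folklore] -/
theorem dressed_add (H δH δH' : Matrix ν ν 𝕜) (Q δQ δQ' : Matrix μ ν 𝕜) :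
    dressed H Q (δH + δH') (δQ + δQ') = dressed H Q δH δQ + dressed H Q δH' δQ' := by
  unfold dressed
  rw [kkt_add, Matrix.mul_add]

/-- Homogeneity of the dressed perturbation. [folklore] -/
theorem dressed_smul (c : 𝕜) (H δH : Matrix ν ν 𝕜) (Q δQ : Matrix μ ν 𝕜) :
    dressed H Q (c • δH) (c • δQ) = c • dressed H Q δH δQ := by
  unfold dressed
  rw [kkt_smul, Matrix.mul_smul]

/-- Additivity of the first-order jet. [folklore] -/
theorem jet₁_add (H δH δH' : Matrix ν ν 𝕜) (Q δQ δQ' : Matrix μ ν 𝕜) :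
    jet₁ H Q (δH + δH') (δQ + δQ') = jet₁ H Q δH δQ + jet₁ H Q δH' δQ' := by
  unfold jet₁
  rw [dressed_add, Matrix.add_mul, neg_add]

/-- Homogeneity of the first-order jet. [folklore] -/
theorem jet₁_smul (c : 𝕜) (H δH : Matrix ν ν 𝕜) (Q δQ : Matrix μ ν 𝕜) :
    jet₁ H Q (c • δH) (c • δQ) = c • jet₁ H Q δH δQ := by
  unfold jet₁
  rw [dressed_smul, Matrix.smul_mul, smul_neg]

/-- THE DRESSED VERTICES, block by block: with `𝒢 = flucCov H Q`, `ℋ = minOp H Q`, `ℋᴸ = minOpL H Q`, `𝒮 = effForm H Q`,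
`X = (kkt H Q)⁻¹ · kkt δH δQ = [[𝒢δH + ℋδQ, 𝒢δQᵀ],[ℋᴸδH − 𝒮δQ, ℋᴸδQᵀ]]`. [folklore] -/
theorem dressed_eq_fromBlocks (H δH : Matrix ν ν 𝕜) (Q δQ : Matrix μ ν 𝕜) :
    dressed H Q δH δQ = Matrix.fromBlocks (flucCov H Q * δH + minOp H Q * δQ) (flucCov H Q * δQᵀ)
      (minOpL H Q * δH - effForm H Q * δQ) (minOpL H Q * δQᵀ) := by
  unfold dressed
  rw [kktInv_eq_fromBlocks, Composition.kkt, Matrix.fromBlocks_multiply]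
  simp only [Matrix.mul_zero, add_zero, Matrix.neg_mul, sub_eq_add_neg]

/-! ## §3. The first-order jets of the four blocks, with their explicit vertex form -/

/-- First-order jet of the FLUCTUATION COVARIANCE: `d𝒢 := (jet₁)₁₁`. [folklore] -/
def dFlucCov (H : Matrix ν ν 𝕜) (Q : Matrix μ ν 𝕜) (δH : Matrix ν ν 𝕜) (δQ : Matrix μ ν 𝕜) : Matrix ν ν 𝕜 :=
  (jet₁ H Q δH δQ).toBlocks₁₁

/-- First-order jet of the MINIMISER: `dℋ := (jet₁)₁₂`. [folklore] -/
def dMinOp (H : Matrix ν ν 𝕜) (Q : Matrix μ ν 𝕜) (δH : Matrix ν ν 𝕜) (δQ : Matrix μ ν 𝕜) : Matrix ν μ 𝕜 :=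
  (jet₁ H Q δH δQ).toBlocks₁₂

/-- First-order jet of the LEFT COMPANION of the minimiser: `dℋᴸ := (jet₁)₂₁`. [folklore] -/
def dMinOpL (H : Matrix ν ν 𝕜) (Q : Matrix μ ν 𝕜) (δH : Matrix ν ν 𝕜) (δQ : Matrix μ ν 𝕜) : Matrix μ ν 𝕜 :=
  (jet₁ H Q δH δQ).toBlocks₂₁

/-- First-order jet of the EFFECTIVE FORM: `d𝒮 := −(jet₁)₂₂` (recall `𝒮 = −(kkt⁻¹)₂₂`). [folklore] -/
def dEffForm (H : Matrix ν ν 𝕜) (Q : Matrix μ ν 𝕜) (δH : Matrix ν ν 𝕜) (δQ : Matrix μ ν 𝕜) : Matrix μ μ 𝕜 :=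
  -(jet₁ H Q δH δQ).toBlocks₂₂

/-- The first-order jet in terms of its four named blocks. [folklore] -/
theorem jet₁_eq_fromBlocks (H δH : Matrix ν ν 𝕜) (Q δQ : Matrix μ ν 𝕜) :
    jet₁ H Q δH δQ = Matrix.fromBlocks (dFlucCov H Q δH δQ) (dMinOp H Q δH δQ) (dMinOpL H Q δH δQ)
      (-dEffForm H Q δH δQ) := by
  unfold dFlucCov dMinOp dMinOpL dEffForm
  rw [neg_neg, Matrix.fromBlocks_toBlocks]

/-- `X · (kkt H Q)⁻¹` block by block. [folklore] -/
theorem dressed_mul_kktInv (H δH : Matrix ν ν 𝕜) (Q δQ : Matrix μ ν 𝕜) :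
    dressed H Q δH δQ * (kkt H Q)⁻¹ = Matrix.fromBlocks
      ((flucCov H Q * δH + minOp H Q * δQ) * flucCov H Q + flucCov H Q * δQᵀ * minOpL H Q)
      ((flucCov H Q * δH + minOp H Q * δQ) * minOp H Q - flucCov H Q * δQᵀ * effForm H Q)
      ((minOpL H Q * δH - effForm H Q * δQ) * flucCov H Q + minOpL H Q * δQᵀ * minOpL H Q)
      ((minOpL H Q * δH - effForm H Q * δQ) * minOp H Q - minOpL H Q * δQᵀ * effForm H Q) := by
  rw [dressed_eq_fromBlocks, kktInv_eq_fromBlocks (H := H) (Q := Q), Matrix.fromBlocks_multiply]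
  simp only [Matrix.mul_neg, sub_eq_add_neg]

/-- THE MINIMISER JET: `dℋ = −𝒢·δH·ℋ − ℋ·δQ·ℋ + 𝒢·δQᵀ·𝒮` — fluctuation propagator × Hessian vertex × minimiser,
minimiser × constraint vertex × minimiser, fluctuation propagator × transposed constraint vertex × effective form.
[folklore] -/
theorem dMinOp_eq (H δH : Matrix ν ν 𝕜) (Q δQ : Matrix μ ν 𝕜) :
    dMinOp H Q δH δQ = -(flucCov H Q * δH * minOp H Q) - minOp H Q * δQ * minOp H Q
      + flucCov H Q * δQᵀ * effForm H Q := by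
  unfold dMinOp jet₁
  rw [dressed_mul_kktInv, Matrix.fromBlocks_neg, Matrix.toBlocks_fromBlocks₁₂, Matrix.add_mul]
  abel

/-- THE EFFECTIVE-FORM JET: `d𝒮 = ℋᴸ·δH·ℋ − 𝒮·δQ·ℋ − ℋᴸ·δQᵀ·𝒮` ("evaluate the Hessian jet on the minimiser, minus
the two constraint-variation terms"). [folklore] -/
theorem dEffForm_eq (H δH : Matrix ν ν 𝕜) (Q δQ : Matrix μ ν 𝕜) :
    dEffForm H Q δH δQ = minOpL H Q * δH * minOp H Q - effForm H Q * δQ * minOp H Q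
      - minOpL H Q * δQᵀ * effForm H Q := by
  unfold dEffForm jet₁
  rw [dressed_mul_kktInv, Matrix.fromBlocks_neg, Matrix.toBlocks_fromBlocks₂₂, neg_neg, Matrix.sub_mul]

/-- THE FLUCTUATION-COVARIANCE JET: `d𝒢 = −𝒢·δH·𝒢 − ℋ·δQ·𝒢 − 𝒢·δQᵀ·ℋᴸ`. [folklore] -/
theorem dFlucCov_eq (H δH : Matrix ν ν 𝕜) (Q δQ : Matrix μ ν 𝕜) :
    dFlucCov H Q δH δQ = -(flucCov H Q * δH * flucCov H Q) - minOp H Q * δQ * flucCov H Q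
      - flucCov H Q * δQᵀ * minOpL H Q := by
  unfold dFlucCov jet₁
  rw [dressed_mul_kktInv, Matrix.fromBlocks_neg, Matrix.toBlocks_fromBlocks₁₁, Matrix.add_mul]
  abel

/-- THE LEFT-COMPANION JET: `dℋᴸ = −ℋᴸ·δH·𝒢 + 𝒮·δQ·𝒢 − ℋᴸ·δQᵀ·ℋᴸ`. [folklore] -/
theorem dMinOpL_eq (H δH : Matrix ν ν 𝕜) (Q δQ : Matrix μ ν 𝕜) :
    dMinOpL H Q δH δQ = -(minOpL H Q * δH * flucCov H Q) + effForm H Q * δQ * flucCov H Q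
      - minOpL H Q * δQᵀ * minOpL H Q := by
  unfold dMinOpL jet₁
  rw [dressed_mul_kktInv, Matrix.fromBlocks_neg, Matrix.toBlocks_fromBlocks₂₁, Matrix.sub_mul]
  abel

/-- Additivity of the block jets in the perturbation (all four at once). [folklore] -/
theorem dBlocks_add (H δH δH' : Matrix ν ν 𝕜) (Q δQ δQ' : Matrix μ ν 𝕜) :
    dFlucCov H Q (δH + δH') (δQ + δQ') = dFlucCov H Q δH δQ + dFlucCov H Q δH' δQ' ∧
      dMinOp H Q (δH + δH') (δQ + δQ') = dMinOp H Q δH δQ + dMinOp H Q δH' δQ' ∧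
      dMinOpL H Q (δH + δH') (δQ + δQ') = dMinOpL H Q δH δQ + dMinOpL H Q δH' δQ' ∧
      dEffForm H Q (δH + δH') (δQ + δQ') = dEffForm H Q δH δQ + dEffForm H Q δH' δQ' := by
  have h := jet₁_add H δH δH' Q δQ δQ'
  rw [jet₁_eq_fromBlocks, jet₁_eq_fromBlocks, jet₁_eq_fromBlocks, Matrix.fromBlocks_add,
    Matrix.fromBlocks_inj] at h
  obtain ⟨h11, h12, h21, h22⟩ := h
  refine ⟨h11, h12, h21, ?_⟩
  rw [← neg_add, neg_inj] at h22
  exact h22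

/-- Homogeneity of the block jets (all four at once). [folklore] -/
theorem dBlocks_smul (c : 𝕜) (H δH : Matrix ν ν 𝕜) (Q δQ : Matrix μ ν 𝕜) :
    dFlucCov H Q (c • δH) (c • δQ) = c • dFlucCov H Q δH δQ ∧
      dMinOp H Q (c • δH) (c • δQ) = c • dMinOp H Q δH δQ ∧
      dMinOpL H Q (c • δH) (c • δQ) = c • dMinOpL H Q δH δQ ∧
      dEffForm H Q (c • δH) (c • δQ) = c • dEffForm H Q δH δQ := by
  have h := jet₁_smul c H δH Q δQ
  rw [jet₁_eq_fromBlocks, jet₁_eq_fromBlocks, Matrix.fromBlocks_smul, Matrix.fromBlocks_inj] at h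
  obtain ⟨h11, h12, h21, h22⟩ := h
  refine ⟨h11, h12, h21, ?_⟩
  rw [smul_neg, neg_inj] at h22
  exact h22

/-! ## §4. Exact perturbation identities for the bordered inverse and its blocks -/

/-- (K1) DYSON FORM: `(kkt (H+δH) (Q+δQ))⁻¹ = (kkt H Q)⁻¹ − X · (kkt (H+δH) (Q+δQ))⁻¹`. [folklore] -/
theorem kktInv_pert (H δH : Matrix ν ν 𝕜) (Q δQ : Matrix μ ν 𝕜) (h : IsUnit (kkt H Q).det)
    (h' : IsUnit (kkt (H + δH) (Q + δQ)).det) :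
    (kkt (H + δH) (Q + δQ))⁻¹ = (kkt H Q)⁻¹ - dressed H Q δH δQ * (kkt (H + δH) (Q + δQ))⁻¹ := by
  rw [kkt_add] at h' ⊢
  exact inv_add_eq_sub_right _ _ h h'

/-- (K2) FIRST-ORDER TAYLOR FORM WITH EXACT REMAINDER:
`(kkt (H+δH) (Q+δQ))⁻¹ = (kkt H Q)⁻¹ + jet₁ + X · X · (kkt (H+δH) (Q+δQ))⁻¹`. [folklore] -/
theorem kktInv_pert₂ (H δH : Matrix ν ν 𝕜) (Q δQ : Matrix μ ν 𝕜) (h : IsUnit (kkt H Q).det)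
    (h' : IsUnit (kkt (H + δH) (Q + δQ)).det) :
    (kkt (H + δH) (Q + δQ))⁻¹ = (kkt H Q)⁻¹ + jet₁ H Q δH δQ
      + dressed H Q δH δQ * dressed H Q δH δQ * (kkt (H + δH) (Q + δQ))⁻¹ := by
  rw [kkt_add] at h' ⊢
  refine (inv_add_eq_second _ _ h h').trans ?_
  unfold jet₁ dressed
  rw [sub_eq_add_neg, Matrix.mul_assoc ((kkt H Q)⁻¹ * kkt δH δQ) (kkt H Q)⁻¹ (kkt δH δQ)]

/-- (K3) SECOND-ORDER TAYLOR FORM WITH EXACT REMAINDER: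
`(kkt (H+δH) (Q+δQ))⁻¹ = (kkt H Q)⁻¹ + jet₁ + jet₂ δ δ − X³ · (kkt (H+δH) (Q+δQ))⁻¹`. [folklore] -/
theorem kktInv_pert₃ (H δH : Matrix ν ν 𝕜) (Q δQ : Matrix μ ν 𝕜) (h : IsUnit (kkt H Q).det)
    (h' : IsUnit (kkt (H + δH) (Q + δQ)).det) :
    (kkt (H + δH) (Q + δQ))⁻¹ = (kkt H Q)⁻¹ + jet₁ H Q δH δQ + jet₂ H Q δH δQ δH δQ
      - dressed H Q δH δQ * dressed H Q δH δQ * dressed H Q δH δQ * (kkt (H + δH) (Q + δQ))⁻¹ := by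
  rw [kkt_add] at h' ⊢
  refine (inv_add_eq_third _ _ h h').trans ?_
  unfold jet₁ jet₂ dressed
  rw [sub_eq_add_neg ((kkt H Q)⁻¹)]

/-- THE FOUR DYSON IDENTITIES (exact, primed blocks on the right): with `𝒢' = flucCov (H+δH) (Q+δQ)` etc.,
`𝒢' = 𝒢 − ((𝒢δH + ℋδQ)𝒢' + 𝒢δQᵀℋᴸ')`, `ℋ' = ℋ − ((𝒢δH + ℋδQ)ℋ' − 𝒢δQᵀ𝒮')`,
`ℋᴸ' = ℋᴸ − ((ℋᴸδH − 𝒮δQ)𝒢' + ℋᴸδQᵀℋᴸ')`, `𝒮' = 𝒮 + ((ℋᴸδH − 𝒮δQ)ℋ' − ℋᴸδQᵀ𝒮')`. [folklore] -/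
theorem blocks_pert (H δH : Matrix ν ν 𝕜) (Q δQ : Matrix μ ν 𝕜) (h : IsUnit (kkt H Q).det)
    (h' : IsUnit (kkt (H + δH) (Q + δQ)).det) :
    flucCov (H + δH) (Q + δQ) = flucCov H Q
        - ((flucCov H Q * δH + minOp H Q * δQ) * flucCov (H + δH) (Q + δQ)
            + flucCov H Q * δQᵀ * minOpL (H + δH) (Q + δQ)) ∧
      minOp (H + δH) (Q + δQ) = minOp H Q
        - ((flucCov H Q * δH + minOp H Q * δQ) * minOp (H + δH) (Q + δQ)
            - flucCov H Q * δQᵀ * effForm (H + δH) (Q + δQ)) ∧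
      minOpL (H + δH) (Q + δQ) = minOpL H Q
        - ((minOpL H Q * δH - effForm H Q * δQ) * flucCov (H + δH) (Q + δQ)
            + minOpL H Q * δQᵀ * minOpL (H + δH) (Q + δQ)) ∧
      effForm (H + δH) (Q + δQ) = effForm H Q
        + ((minOpL H Q * δH - effForm H Q * δQ) * minOp (H + δH) (Q + δQ)
            - minOpL H Q * δQᵀ * effForm (H + δH) (Q + δQ)) := by
  have hK := kktInv_pert H δH Q δQ h h'
  rw [kktInv_eq_fromBlocks, kktInv_eq_fromBlocks (H := H) (Q := Q), dressed_eq_fromBlocks,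
    Matrix.fromBlocks_multiply, sub_eq_add_neg, Matrix.fromBlocks_neg, Matrix.fromBlocks_add,
    Matrix.fromBlocks_inj] at hK
  obtain ⟨h11, h12, h21, h22⟩ := hK
  have h22' := congrArg Neg.neg h22
  rw [neg_neg] at h22'
  refine ⟨h11.trans ?_, h12.trans ?_, h21.trans ?_, h22'.trans ?_⟩
  · abel
  · rw [Matrix.mul_neg]; abel
  · abel
  · rw [Matrix.mul_neg]; abel

/-- FIRST-ORDER EXPANSION OF THE FOUR BLOCKS WITH EXACT SECOND-ORDER REMAINDER: writing
`R := X · X · (kkt (H+δH) (Q+δQ))⁻¹` (second order in the perturbation),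
`𝒢' = 𝒢 + d𝒢 + R₁₁`, `ℋ' = ℋ + dℋ + R₁₂`, `ℋᴸ' = ℋᴸ + dℋᴸ + R₂₁`, `𝒮' = 𝒮 + d𝒮 − R₂₂`. [folklore] -/
theorem blocks_pert₂ (H δH : Matrix ν ν 𝕜) (Q δQ : Matrix μ ν 𝕜) (h : IsUnit (kkt H Q).det)
    (h' : IsUnit (kkt (H + δH) (Q + δQ)).det) :
    flucCov (H + δH) (Q + δQ) = flucCov H Q + dFlucCov H Q δH δQ
        + (dressed H Q δH δQ * dressed H Q δH δQ * (kkt (H + δH) (Q + δQ))⁻¹).toBlocks₁₁ ∧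
      minOp (H + δH) (Q + δQ) = minOp H Q + dMinOp H Q δH δQ
        + (dressed H Q δH δQ * dressed H Q δH δQ * (kkt (H + δH) (Q + δQ))⁻¹).toBlocks₁₂ ∧
      minOpL (H + δH) (Q + δQ) = minOpL H Q + dMinOpL H Q δH δQ
        + (dressed H Q δH δQ * dressed H Q δH δQ * (kkt (H + δH) (Q + δQ))⁻¹).toBlocks₂₁ ∧
      effForm (H + δH) (Q + δQ) = effForm H Q + dEffForm H Q δH δQ
        - (dressed H Q δH δQ * dressed H Q δH δQ * (kkt (H + δH) (Q + δQ))⁻¹).toBlocks₂₂ := by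
  have hK := kktInv_pert₂ H δH Q δQ h h'
  set R := dressed H Q δH δQ * dressed H Q δH δQ * (kkt (H + δH) (Q + δQ))⁻¹ with hR
  rw [kktInv_eq_fromBlocks, kktInv_eq_fromBlocks (H := H) (Q := Q), jet₁_eq_fromBlocks,
    ← Matrix.fromBlocks_toBlocks R, Matrix.fromBlocks_add, Matrix.fromBlocks_add, Matrix.fromBlocks_inj] at hK
  obtain ⟨h11, h12, h21, h22⟩ := hK
  refine ⟨h11, h12, h21, ?_⟩
  rw [← neg_inj, h22, neg_sub, sub_eq_neg_add, neg_add]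

/-! ## §5. Second order: the blocks of `jet₂` and the Taylor identity along a polynomial line of data -/

/-- The `₁₂` (minimiser) block of the second-order jet: `(jet₂ δ δ')₁₂ = −(𝒢δH + ℋδQ)·dℋ(δ') + 𝒢δQᵀ·d𝒮(δ')`.
[folklore] -/
theorem jet₂_toBlocks₁₂ (H δH δH' : Matrix ν ν 𝕜) (Q δQ δQ' : Matrix μ ν 𝕜) :
    (jet₂ H Q δH δQ δH' δQ').toBlocks₁₂ = -((flucCov H Q * δH + minOp H Q * δQ) * dMinOp H Q δH' δQ')
      + flucCov H Q * δQᵀ * dEffForm H Q δH' δQ' := by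
  rw [jet₂_eq_neg_dressed_mul_jet₁, dressed_eq_fromBlocks, jet₁_eq_fromBlocks, Matrix.fromBlocks_multiply,
    Matrix.fromBlocks_neg, Matrix.toBlocks_fromBlocks₁₂, Matrix.mul_neg, neg_add, neg_neg]

/-- The `₂₂` block of the second-order jet, sign-adjusted to the effective form:
`−(jet₂ δ δ')₂₂ = (ℋᴸδH − 𝒮δQ)·dℋ(δ') − ℋᴸδQᵀ·d𝒮(δ')` — the second-order coefficient of `𝒮` contributed by two
first-order vertices. [folklore] -/
theorem neg_jet₂_toBlocks₂₂ (H δH δH' : Matrix ν ν 𝕜) (Q δQ δQ' : Matrix μ ν 𝕜) :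
    -(jet₂ H Q δH δQ δH' δQ').toBlocks₂₂ = (minOpL H Q * δH - effForm H Q * δQ) * dMinOp H Q δH' δQ'
      - minOpL H Q * δQᵀ * dEffForm H Q δH' δQ' := by
  rw [jet₂_eq_neg_dressed_mul_jet₁, dressed_eq_fromBlocks, jet₁_eq_fromBlocks, Matrix.fromBlocks_multiply,
    Matrix.fromBlocks_neg, Matrix.toBlocks_fromBlocks₂₂, neg_neg, Matrix.mul_neg, ← sub_eq_add_neg]

/-- The `₁₁` (fluctuation covariance) block of the second-order jet:
`(jet₂ δ δ')₁₁ = −(𝒢δH + ℋδQ)·d𝒢(δ') − 𝒢δQᵀ·dℋᴸ(δ')`. [folklore] -/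
theorem jet₂_toBlocks₁₁ (H δH δH' : Matrix ν ν 𝕜) (Q δQ δQ' : Matrix μ ν 𝕜) :
    (jet₂ H Q δH δQ δH' δQ').toBlocks₁₁ = -((flucCov H Q * δH + minOp H Q * δQ) * dFlucCov H Q δH' δQ')
      - flucCov H Q * δQᵀ * dMinOpL H Q δH' δQ' := by
  rw [jet₂_eq_neg_dressed_mul_jet₁, dressed_eq_fromBlocks, jet₁_eq_fromBlocks, Matrix.fromBlocks_multiply,
    Matrix.fromBlocks_neg, Matrix.toBlocks_fromBlocks₁₁, neg_add, ← sub_eq_add_neg]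

/-- The exact remainder of the second-order Taylor identity along the polynomial line of data
`t ↦ (H + tH₁ + t²H₂, Q + tQ₁ + t²Q₂)`: with `Xᵢ := dressed H Q Hᵢ Qᵢ`, `Y(t) := X₁ + t·X₂`,
`lineRem t := (X₁X₂ + X₂X₁ + t·X₂X₂)·(kkt H Q)⁻¹ − Y(t)³·(kkt (H(t)) (Q(t)))⁻¹`. [folklore] -/
def lineRem (H H₁ H₂ : Matrix ν ν 𝕜) (Q Q₁ Q₂ : Matrix μ ν 𝕜) (t : 𝕜) : Matrix (ν ⊕ μ) (ν ⊕ μ) 𝕜 :=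
  (dressed H Q H₁ Q₁ * dressed H Q H₂ Q₂ + dressed H Q H₂ Q₂ * dressed H Q H₁ Q₁
      + t • (dressed H Q H₂ Q₂ * dressed H Q H₂ Q₂)) * (kkt H Q)⁻¹
    - (dressed H Q H₁ Q₁ + t • dressed H Q H₂ Q₂) * (dressed H Q H₁ Q₁ + t • dressed H Q H₂ Q₂)
        * (dressed H Q H₁ Q₁ + t • dressed H Q H₂ Q₂)
        * (kkt (H + (t • H₁ + t ^ 2 • H₂)) (Q + (t • Q₁ + t ^ 2 • Q₂)))⁻¹

/-- SECOND-ORDER TAYLOR IDENTITY for the bordered inverse along a polynomial line of data: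
`(kkt H(t) Q(t))⁻¹ = (kkt H Q)⁻¹ + t·jet₁(H₁,Q₁) + t²·(jet₂((H₁,Q₁),(H₁,Q₁)) + jet₁(H₂,Q₂)) + t³·lineRem t`.
So the `t`-coefficient ("first B-jet") is `jet₁(H₁,Q₁)` and the `t²`-coefficient ("second B-jet") is
`jet₂((H₁,Q₁),(H₁,Q₁)) + jet₁(H₂,Q₂)`: two first-order vertices joined by a propagator PLUS one second-order vertex.
Purely algebraic (exact remainder), valid wherever both bordered matrices are invertible. [folklore] -/
theorem kktInv_line_taylor₂ (H H₁ H₂ : Matrix ν ν 𝕜) (Q Q₁ Q₂ : Matrix μ ν 𝕜) (t : 𝕜)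
    (h : IsUnit (kkt H Q).det) (ht : IsUnit (kkt (H + (t • H₁ + t ^ 2 • H₂)) (Q + (t • Q₁ + t ^ 2 • Q₂))).det) :
    (kkt (H + (t • H₁ + t ^ 2 • H₂)) (Q + (t • Q₁ + t ^ 2 • Q₂)))⁻¹ = (kkt H Q)⁻¹ + t • jet₁ H Q H₁ Q₁
      + t ^ 2 • (jet₂ H Q H₁ Q₁ H₁ Q₁ + jet₁ H Q H₂ Q₂) + t ^ 3 • lineRem H H₁ H₂ Q Q₁ Q₂ t := by
  unfold lineRem jet₁ jet₂ dressed
  rw [kkt_line] at ht ⊢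
  refine (inv_line_taylor₂ _ _ _ t h ht).trans ?_
  rw [sub_eq_add_neg (((kkt H Q)⁻¹ * kkt H₁ Q₁ * ((kkt H Q)⁻¹ * kkt H₁ Q₁)) * (kkt H Q)⁻¹)]

/-- THE MINIMISER AND THE EFFECTIVE FORM TO SECOND ORDER along the polynomial line of data (block read-out of
`kktInv_line_taylor₂`): with `dℋ(i) := dMinOp H Q Hᵢ Qᵢ`, `d𝒮(i) := dEffForm H Q Hᵢ Qᵢ`, `X₁ = dressed H Q H₁ Q₁`,
`ℋ(t) = ℋ + t·dℋ(1) + t²·(−(𝒢H₁ + ℋQ₁)·dℋ(1) + 𝒢Q₁ᵀ·d𝒮(1) + dℋ(2)) + t³·(lineRem t)₁₂`,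
`𝒮(t) = 𝒮 + t·d𝒮(1) + t²·(d𝒮(2) + (ℋᴸH₁ − 𝒮Q₁)·dℋ(1) − ℋᴸQ₁ᵀ·d𝒮(1)) − t³·(lineRem t)₂₂`
— «the B-jets of the minimiser and of the effective action to second order at B = 0». [folklore] -/
theorem minOp_effForm_line_taylor₂ (H H₁ H₂ : Matrix ν ν 𝕜) (Q Q₁ Q₂ : Matrix μ ν 𝕜) (t : 𝕜)
    (h : IsUnit (kkt H Q).det) (ht : IsUnit (kkt (H + (t • H₁ + t ^ 2 • H₂)) (Q + (t • Q₁ + t ^ 2 • Q₂))).det) :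
    minOp (H + (t • H₁ + t ^ 2 • H₂)) (Q + (t • Q₁ + t ^ 2 • Q₂)) = minOp H Q + t • dMinOp H Q H₁ Q₁
        + t ^ 2 • (-((flucCov H Q * H₁ + minOp H Q * Q₁) * dMinOp H Q H₁ Q₁)
            + flucCov H Q * Q₁ᵀ * dEffForm H Q H₁ Q₁ + dMinOp H Q H₂ Q₂)
        + t ^ 3 • (lineRem H H₁ H₂ Q Q₁ Q₂ t).toBlocks₁₂ ∧
      effForm (H + (t • H₁ + t ^ 2 • H₂)) (Q + (t • Q₁ + t ^ 2 • Q₂)) = effForm H Q + t • dEffForm H Q H₁ Q₁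
        + t ^ 2 • (dEffForm H Q H₂ Q₂ + ((minOpL H Q * H₁ - effForm H Q * Q₁) * dMinOp H Q H₁ Q₁
            - minOpL H Q * Q₁ᵀ * dEffForm H Q H₁ Q₁))
        - t ^ 3 • (lineRem H H₁ H₂ Q Q₁ Q₂ t).toBlocks₂₂ := by
  have hK := kktInv_line_taylor₂ H H₁ H₂ Q Q₁ Q₂ t h ht
  have hJ2 := (Matrix.fromBlocks_toBlocks (jet₂ H Q H₁ Q₁ H₁ Q₁)).symm
  rw [jet₂_toBlocks₁₂] at hJ2
  set R := lineRem H H₁ H₂ Q Q₁ Q₂ t with hR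
  rw [kktInv_eq_fromBlocks, kktInv_eq_fromBlocks (H := H) (Q := Q), jet₁_eq_fromBlocks, jet₁_eq_fromBlocks, hJ2,
    ← Matrix.fromBlocks_toBlocks R, Matrix.fromBlocks_add, Matrix.fromBlocks_smul, Matrix.fromBlocks_smul,
    Matrix.fromBlocks_smul, Matrix.fromBlocks_add, Matrix.fromBlocks_add, Matrix.fromBlocks_add,
    Matrix.fromBlocks_inj] at hK
  obtain ⟨-, h12, -, h22⟩ := hK
  refine ⟨h12, ?_⟩
  rw [← neg_inj, h22, ← neg_jet₂_toBlocks₂₂]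
  simp only [smul_add, smul_neg, neg_sub]
  abel

/-! ## §6. Specialisations: pure Hessian perturbation (`δQ = 0`) and symmetric data -/

/-- PURE HESSIAN PERTURBATION (`δQ = 0`; e.g. the constraint map does not depend on the background): the minimiser
jet is `dℋ = −𝒢·δH·ℋ`, the effective-form jet is `d𝒮 = ℋᴸ·δH·ℋ` (HELLMANN–FEYNMAN: the first variation of the
constrained minimum is the Hessian variation evaluated on the unperturbed minimiser), `d𝒢 = −𝒢·δH·𝒢`,
`dℋᴸ = −ℋᴸ·δH·𝒢`. [folklore] -/
theorem dBlocks_hessian (H δH : Matrix ν ν 𝕜) (Q : Matrix μ ν 𝕜) :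
    dMinOp H Q δH 0 = -(flucCov H Q * δH * minOp H Q) ∧
      dEffForm H Q δH 0 = minOpL H Q * δH * minOp H Q ∧
      dFlucCov H Q δH 0 = -(flucCov H Q * δH * flucCov H Q) ∧
      dMinOpL H Q δH 0 = -(minOpL H Q * δH * flucCov H Q) := by
  refine ⟨?_, ?_, ?_, ?_⟩
  · rw [dMinOp_eq]; simp
  · rw [dEffForm_eq]; simp
  · rw [dFlucCov_eq]; simp
  · rw [dMinOpL_eq]; simp

/-- PURE HESSIAN PERTURBATION, second order: the two-vertex contribution to the effective form is
`−(jet₂ (δH,0) (δH',0))₂₂ = −ℋᴸ·δH·𝒢·δH'·ℋ` — two Hessian vertices on minimiser legs joined by ONE fluctuation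
propagator (second-order perturbation theory of the constrained minimum). [folklore] -/
theorem neg_jet₂_toBlocks₂₂_hessian (H δH δH' : Matrix ν ν 𝕜) (Q : Matrix μ ν 𝕜) :
    -(jet₂ H Q δH 0 δH' 0).toBlocks₂₂ = -(minOpL H Q * δH * (flucCov H Q * δH' * minOp H Q)) := by
  rw [neg_jet₂_toBlocks₂₂, (dBlocks_hessian H δH' Q).1]
  simp [Matrix.mul_neg]

/-- SYMMETRIC DATA (`Hᵀ = H`): the left companion is the transpose of the minimiser
(`CompositionSingular.minOpL_eq_transpose`), so the effective-form jet reads `d𝒮 = ℋᵀ·δH·ℋ − 𝒮·δQ·ℋ − ℋᵀ·δQᵀ·𝒮`.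
[folklore] -/
theorem dEffForm_eq_of_symm (H δH : Matrix ν ν 𝕜) (Q δQ : Matrix μ ν 𝕜) (hH : Hᵀ = H) :
    dEffForm H Q δH δQ = (minOp H Q)ᵀ * δH * minOp H Q - effForm H Q * δQ * minOp H Q
      - (minOp H Q)ᵀ * δQᵀ * effForm H Q := by
  rw [dEffForm_eq, (minOpL_eq_transpose H Q hH).1]

/-- SYMMETRIC DATA: the two constraint-variation terms of `d𝒮` are transposes of each other,
`ℋᵀ·δQᵀ·𝒮 = (𝒮·δQ·ℋ)ᵀ` (`𝒮ᵀ = 𝒮`, `minOpL_eq_transpose`), so `d𝒮 = ℋᵀδHℋ − (𝒮δQℋ + (𝒮δQℋ)ᵀ)`; in particular `d𝒮`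
is symmetric when `δH` is. [folklore] -/
theorem dEffForm_eq_of_symm' (H δH : Matrix ν ν 𝕜) (Q δQ : Matrix μ ν 𝕜) (hH : Hᵀ = H) :
    dEffForm H Q δH δQ = (minOp H Q)ᵀ * δH * minOp H Q
      - (effForm H Q * δQ * minOp H Q + (effForm H Q * δQ * minOp H Q)ᵀ) := by
  rw [dEffForm_eq_of_symm H δH Q δQ hH, Matrix.transpose_mul, Matrix.transpose_mul,
    (minOpL_eq_transpose H Q hH).2.2, ← Matrix.mul_assoc, sub_sub]

/-- SYMMETRIC DATA, pure Hessian perturbation: `d𝒮 = ℋᵀ·δH·ℋ` and the two-vertex second-order term is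
`−ℋᵀ·δH·𝒢·δH'·ℋ`. [folklore] -/
theorem effForm_jets_hessian_of_symm (H δH δH' : Matrix ν ν 𝕜) (Q : Matrix μ ν 𝕜) (hH : Hᵀ = H) :
    dEffForm H Q δH 0 = (minOp H Q)ᵀ * δH * minOp H Q ∧
      -(jet₂ H Q δH 0 δH' 0).toBlocks₂₂ = -((minOp H Q)ᵀ * δH * (flucCov H Q * δH' * minOp H Q)) := by
  rw [(dBlocks_hessian H δH Q).2.1, neg_jet₂_toBlocks₂₂_hessian, (minOpL_eq_transpose H Q hH).1]
  exact ⟨rfl, rfl⟩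

/-! ## §7. Traces: the dressed perturbation's trace ("tadpole vertex sum") -/

omit [DecidableEq ν] [DecidableEq μ] in
/-- Trace of a square block matrix = sum of the diagonal blocks' traces. [folklore] -/
theorem trace_fromBlocks' (A : Matrix ν ν 𝕜) (B : Matrix ν μ 𝕜) (C : Matrix μ ν 𝕜) (D : Matrix μ μ 𝕜) :
    (Matrix.fromBlocks A B C D).trace = A.trace + D.trace := by
  simp [Matrix.trace, Fintype.sum_sum_type]

/-- THE TRACE OF THE DRESSED PERTURBATION: `tr X = tr (𝒢δH + ℋδQ) + tr (ℋᴸδQᵀ)` — the fluctuation loop closed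
with the Hessian vertex, plus the minimiser contracted with the constraint vertex (twice, see
`trace_dressed_of_symm`). [folklore] -/
theorem trace_dressed (H δH : Matrix ν ν 𝕜) (Q δQ : Matrix μ ν 𝕜) :
    (dressed H Q δH δQ).trace = (flucCov H Q * δH + minOp H Q * δQ).trace + (minOpL H Q * δQᵀ).trace := by
  rw [dressed_eq_fromBlocks, trace_fromBlocks']

/-- Symmetric data: `tr X = tr (𝒢δH) + 2·tr (ℋδQ)` (`ℋᴸ = ℋᵀ`, `tr (ℋᵀδQᵀ) = tr (δQℋ)ᵀ = tr (ℋδQ)`). [folklore] -/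
theorem trace_dressed_of_symm (H δH : Matrix ν ν 𝕜) (Q δQ : Matrix μ ν 𝕜) (hH : Hᵀ = H) :
    (dressed H Q δH δQ).trace = (flucCov H Q * δH).trace + 2 * (minOp H Q * δQ).trace := by
  rw [trace_dressed, (minOpL_eq_transpose H Q hH).1, ← Matrix.transpose_mul, Matrix.trace_transpose,
    Matrix.trace_mul_comm δQ, Matrix.trace_add]
  ring

end Bordered

/-! ## §8. Over `ℝ`: the first derivative of `log det` along a line of data (the one-loop "tadpole") -/

section RealLine

open Literature.Analysis.Calculus

variable {ι : Type*} [Fintype ι] [DecidableEq ι]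
variable {ν μ : Type*} [Fintype ν] [Fintype μ] [DecidableEq ν] [DecidableEq μ]

/-- JACOBI ALONG AN AFFINE LINE OF MATRICES: if `det M ≠ 0` then `t ↦ log det (M + tD)` (Mathlib's `Real.log`, i.e.
`log |det|`) has derivative `tr (M⁻¹D)` at `t = 0` — from the tree's `JacobiFormula.hasDerivAt_det_eq_det_mul_trace`
BY NAME. [folklore] -/
theorem hasDerivAt_log_det_line (M D : Matrix ι ι ℝ) (hM : M.det ≠ 0) :
    HasDerivAt (fun t : ℝ => Real.log (M + t • D).det) ((M⁻¹ * D).trace) 0 := by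
  have hcurve : HasDerivAt (fun t : ℝ => ((M : ι → ι → ℝ) + t • (D : ι → ι → ℝ))) (D : ι → ι → ℝ) 0 :=
    hasDerivAt_add_smul_matrix (M : ι → ι → ℝ) (D : ι → ι → ℝ) 0
  have h0 : Matrix.of ((M : ι → ι → ℝ) + (0 : ℝ) • (D : ι → ι → ℝ)) = M := by
    simp
    rfl
  have hdet := hasDerivAt_det_eq_det_mul_trace hcurve (by rw [h0]; exact isUnit_iff_ne_zero.mpr hM)
  rw [h0] at hdet
  have hlog := hdet.log (by rw [h0]; exact hM)
  have hfun : (fun u : ℝ => Real.log (Matrix.of ((M : ι → ι → ℝ) + u • (D : ι → ι → ℝ))).det)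
      = fun t : ℝ => Real.log (M + t • D).det := by
    funext u
    rfl
  rw [hfun, h0] at hlog
  convert hlog using 1
  field_simp

/-- THE ONE-LOOP TADPOLE OF A CONSTRAINED GAUSSIAN along an affine line of data `t ↦ (H + tH₁, Q + tQ₁)`:
`d/dt|₀ log det kkt (H + tH₁) (Q + tQ₁) = tr (𝒢H₁ + ℋQ₁) + tr (ℋᴸQ₁ᵀ) = tr X₁` (for `det kkt H Q ≠ 0`; `log = log |·|`).
The loop side of `∂_B log Z` at one loop for a Gaussian normalisation `Z ∝ |det kkt|^{-1/2}`; the SECOND derivative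
(`tr X₂ − ½ tr X₁²` for a polynomial line) is not restated here — it is the tree's
`Beta.LogDetHessian.fderiv_fderiv_log_det`. [folklore] -/
theorem hasDerivAt_log_det_kkt_line (H H₁ : Matrix ν ν ℝ) (Q Q₁ : Matrix μ ν ℝ) (h : (kkt H Q).det ≠ 0) :
    HasDerivAt (fun t : ℝ => Real.log (kkt (H + t • H₁) (Q + t • Q₁)).det)
      ((flucCov H Q * H₁ + minOp H Q * Q₁).trace + (minOpL H Q * Q₁ᵀ).trace) 0 := by
  have hfun : (fun t : ℝ => Real.log (kkt (H + t • H₁) (Q + t • Q₁)).det)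
      = fun t : ℝ => Real.log (kkt H Q + t • kkt H₁ Q₁).det := by
    funext t
    rw [kkt_add, kkt_smul]
  rw [hfun, ← trace_dressed]
  exact hasDerivAt_log_det_line (kkt H Q) (kkt H₁ Q₁) h

/-- Symmetric data: the tadpole is `tr (𝒢H₁) + 2·tr (ℋQ₁)`. [folklore] -/
theorem hasDerivAt_log_det_kkt_line_of_symm (H H₁ : Matrix ν ν ℝ) (Q Q₁ : Matrix μ ν ℝ) (hH : Hᵀ = H)
    (h : (kkt H Q).det ≠ 0) :
    HasDerivAt (fun t : ℝ => Real.log (kkt (H + t • H₁) (Q + t • Q₁)).det)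
      ((flucCov H Q * H₁).trace + 2 * (minOp H Q * Q₁).trace) 0 := by
  have hd := hasDerivAt_log_det_kkt_line H H₁ Q Q₁ h
  rwa [← trace_dressed, trace_dressed_of_symm H H₁ Q Q₁ hH] at hd

end RealLine

/-! ## §9. Non-vacuity: the one-dimensional datum `H = 1`, `Q = 1`, perturbed by `δH = 1`, `δQ = 0` -/

section Example

/-- Non-vacuity of the standing hypotheses: for `ν = μ = Unit`, `H = 1`, `Q = 1` the bordered matrix `[[1,1],[1,0]]`
is invertible (left inverse `[[0,1],[1,−1]]`), and so is the perturbed one `[[2,1],[1,0]]` (left inverse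
`[[0,1],[1,−2]]`). -/
example : IsUnit (kkt (1 : Matrix Unit Unit ℚ) (1 : Matrix Unit Unit ℚ)).det ∧
    IsUnit (kkt ((1 : Matrix Unit Unit ℚ) + 1) ((1 : Matrix Unit Unit ℚ) + 0)).det := by
  constructor
  · refine Matrix.isUnit_det_of_left_inverse (B := Matrix.fromBlocks 0 1 1 (-1)) ?_
    unfold kkt
    rw [Matrix.fromBlocks_multiply, ← Matrix.fromBlocks_one]
    simp
  · refine Matrix.isUnit_det_of_left_inverse (B := Matrix.fromBlocks 0 1 1 (-(1 + 1))) ?_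
    unfold kkt
    rw [Matrix.fromBlocks_multiply, ← Matrix.fromBlocks_one]
    simp

end Example

end Literature.MathematicalPhysics.QuantumFieldTheory.Balaban1983to89.Beta.BorderedJets

end
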